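import HarnessLib
import Summits.Langlands.Langlands.Theses.PhantomRMYoshida
import Literature.AlgebraicGeometry.Motives.AbelianVarietyExistence
import Literature.AlgebraicGeometry.Motives.AbelianVarietyKerRankProofs
import Literature.AlgebraicGeometry.Motives.AbelianVarietyLie

/-!
# `FaltingsFinitenessI` (stmt-Langlands-15084) — Negative knowledge II: the `∀ g`-form of the
# minimal-isogeny bound is false

The picked line of the crux (Cruxes/FaltingsFinitenessI, `Lines/Sketch`, card `isogeny-degree-bound`)
transfers Finiteness I over `ℚ` to the minimal-isogeny bound
`IsogenyKernelBound : ∀ A, ∃ N, ∀ B, IsIsogenous B A → ∃ g : A ⟶ B, IsIsogeny g ∧ Hom.kerRank g ≤ N`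
(Masser–Wüstholz 1993 / Gaudron–Rémond 2014, a theorem in print). From the standing disprover's
`Disproof.lean` (cdisprove cycle 1): the STRENGTHENING with `∀ g` in place of `∃ g` — every isogeny out of
`A` has bounded kernel rank — is false, already at `B = A` an elliptic curve: `[N+1]_E` is an isogeny
(`isIsogeny_zsmul_id_holds_of_charZero`) of kernel rank `(N+1)^2 > N` (`kerRank_zsmul_id_holds`,
Görtz–Wedhorn II Prop. 27.186). Provers discharging the counting reduction P1/P2 must keep the `∃ g` form.
No statement of the route is used or asserted. [folklore]
-/

set_option linter.dupNamespace false -- project-wide option (lakefile weak.linter.dupNamespace); `Summit.Langlands.Langlands` is the mandated namespace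

open CategoryTheory AlgebraicGeometry
open Literature.AlgebraicGeometry.Motives
open Literature.AlgebraicGeometry.Motives.AbelianVariety

namespace Summit.Langlands.Langlands.Theorems.FaltingsFinitenessI.Negative

/-- **Kernel ranks of isogenies out of a fixed abelian variety over `ℚ` are unbounded**: on an elliptic
curve `E/ℚ` (`exists_abelianVariety_dim_eq_one`), `[N+1]_E` is an isogeny `E → E` with
`kerRank = (N+1)^2 > N` for every `N` (Görtz–Wedhorn II, Prop. 27.186: `deg [n] = n^{2g}`).
[cite: GortzWedhorn2023, Prop. 27.186 (p. 887)] -/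
theorem exists_isogeny_kerRank_gt :
    ∃ E : AbelianVariety ℚ, ∀ N : ℕ, ∃ g : E ⟶ E, IsIsogeny g ∧ N < Hom.kerRank g := by
  obtain ⟨E, hE⟩ := exists_abelianVariety_dim_eq_one ℚ
  refine ⟨E, fun N => ⟨((N : ℤ) + 1) • 𝟙 E, ?_, ?_⟩⟩
  · exact isIsogeny_zsmul_id_holds_of_charZero _ (by exact_mod_cast Nat.succ_ne_zero N)
  · have hne : ((N : ℤ) + 1) ≠ 0 := by positivity
    have hk : Hom.kerRank (((N : ℤ) + 1) • 𝟙 E) = ((N : ℤ) + 1).natAbs ^ (2 * E.dim) :=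
      kerRank_zsmul_id_holds E _ hne
    have hab : ((N : ℤ) + 1).natAbs = N + 1 := by omega
    rw [hk, hE, hab, Nat.mul_one, Nat.pow_two]
    nlinarith

/-- **The `∀ g`-form of `IsogenyKernelBound` is false**: it is not true that for every `A/ℚ` some `N`
bounds the kernel rank of EVERY isogeny `A → B` onto an isogenous `B` (witness `B = A = E`,
`g = [N+1]`, `exists_isogeny_kerRank_gt`). Only the `∃ g` form (Masser–Wüstholz) holds.
[cite: GortzWedhorn2023, Prop. 27.186 (p. 887)] -/
theorem not_isogenyKernelBound_forall :
    ¬ ∀ A : AbelianVariety ℚ, ∃ N : ℕ, ∀ B : AbelianVariety ℚ, IsIsogenous B A →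
      ∀ g : A ⟶ B, IsIsogeny g → Hom.kerRank g ≤ N := by
  intro h
  obtain ⟨E, hE⟩ := exists_isogeny_kerRank_gt
  obtain ⟨N, hN⟩ := h E
  obtain ⟨g, hg, hlt⟩ := hE N
  exact absurd (hN E (IsIsogenous.refl E) g hg) (not_le.mpr hlt)

end Summit.Langlands.Langlands.Theorems.FaltingsFinitenessI.Negative
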